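import Literature.Combinatorics.Optimization.PentagonsPsdRankFour
import HarnessLib

/-!
# The nested rectangles `[−a,a]×[−b,b] ⊆ [−1,1]²`: psd rank `3 / 2 / 1` according to `a² + b²`
# (FGPRT Example 3.6) and the nested squares of GRT "Worst-case results" Example 4.2 — PROVED

Sources. H. Fawzi, J. Gouveia, P. A. Parrilo, R. Z. Robinson, R. R. Thomas, *Positive semidefinite
rank*, Math. Program. 153 (2015) 133–177 = arXiv:1407.4095 [FawziEtAl2015] (held text
`paper:arxiv-1407.4095`, p10 L52–70), Example 3.6 (verbatim): "Let `Q = [−1,1]²` and let now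
`P = [−a,a] × [−b,b]` be the rectangle centered at the origin with side lengths `2a` and `2b` with
`0 ≤ a,b ≤ 1` … The slack matrix of the pair `P,Q` … is given by
`M = [[1+a,1+b,1−a,1−b],[1−a,1+b,1+a,1−b],[1−a,1−b,1+a,1+b],[1+a,1−b,1−a,1+b]]` … we saw a
spectrahedron of size 3 which projects onto `Q = [−1,1]²` and thus this shows that `rank_psd M ≤ 3`
for all `a,b ≤ 1`. … One can actually show that the psd rank of `M` is equal to 2 if, and only if,
there is an ellipse `E` such that `P ⊆ E ⊆ Q` (cf. e.g., [gouveia2013worst]). It is not hard to see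
that such an ellipse exists if and only if `a² + b² ≤ 1`. Thus … `rank_psd M = 3` if `a² + b² > 1`,
`2` if `0 < a² + b² ≤ 1`, `1` if `a = b = 0`." And J. Gouveia, R. Z. Robinson, R. R. Thomas,
*Worst-case results for positive semidefinite rank*, Math. Program. 153 (2015) 201–212 =
arXiv:1305.4600 [GouveiaRobinsonThomas2015] (held text `paper:arxiv-1305.4600`, p08 L16–27),
Example 4.2 (verbatim): "`M_ε = [[2−ε,2−ε,ε,ε],[ε,2−ε,2−ε,ε],[ε,ε,2−ε,2−ε],[2−ε,ε,ε,2−ε]]` with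
`ε ∈ [0,1]` … `M_ε = S_{(1−ε)P,P}` where `P` is the `±1` square. It is easy to see that we can put a
half-conic between `(1−ε)P` and `P` if and only if `1 − ε ≤ √2/2` … `rank_psd M_ε = 1` if `ε = 1`;
`2` if `ε ∈ [1 − √2/2, 1)`; `3` if `ε ∈ [0, 1 − √2/2)`." (`M_ε` is the matrix of Example 3.6 with
`a = b = 1 − ε`.)

Everything is PROVED (no named facts), on top of the tree's §4 characterisation
`FawziEtAl2015_sec4_ellipse_holds` (`rank_psd S_{P,Q} = 2` iff a nondegenerate ellipse is
sandwiched, for bounded `Q` and `rank S_{P,Q} = 3`; `PsdLiftSlackMatrix.lean`):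

* `rectVertex`, `squareNormal`, `nestedRectSlack a b = S_{P,Q}` (`pairSlackMatrix`) and its printed
  form `nestedRectSlack_eq`; `nestedSquareSlack ε = nestedRectSlack (1−ε) (1−ε)`, `nestedSquareSlack_eq`.
* `hasPsdFactorization_nestedRectSlack_three` (size `3` for all `0 ≤ a, b ≤ 1`): `Mᵀ` is the
  generalized slack matrix of the polar diamond `conv{±e₁,±e₂}` (a quadrilateral: psd rank `3`,
  GRT13 Thm. 4.7) against valid functionals, GRT Prop. 3.6 at matrix level
  (`IsConvexPolygon.hasPsdFactorization_of_valid`) — a recorded substitute for the printed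
  "spectrahedron of size 3 projecting onto `Q`" (Example 3.5), same bound.
* `rank_nestedRectSlack` (`= 3` for `ab ≠ 0`: the leading `3 × 3` minor is `8ab`).
* `sq_add_sq_le_one_of_ellipse_between` — the sentence "such an ellipse exists if and only if
  `a² + b² ≤ 1`", necessity, by AVERAGING the ellipse's quadratic over the four sign symmetries of
  the configuration (the printed "it is not hard to see" made explicit); sufficiency is the unit disk.
* `hasPsdFactorization_nestedRectSlack_two_iff` (size `2` iff `a² + b² ≤ 1`),
  `hasPsdFactorization_nestedRectSlack_one_iff` (size `1` iff `a = b = 0`, by two `2 × 2` minors),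
  **`FawziEtAl2015_ex36`** / `FawziEtAl2015_ex36_cases` (the printed three-way formula), and
  **`GouveiaRobinsonThomas2015_ex42`** (size `2` iff `1 − ε ≤ √2/2`, size `1` iff `ε = 1`).

NOT here: GRT 2015 Prop. 4.1 for UNBOUNDED `Q` (half-conics: parabolas, hyperbola branches),
Prop. 4.4–4.5 and Thm. 4.6 (MIN PSD RANK and its complexity); the SDP (1)–(3) of FGPRT §4.
-/

noncomputable section

open Matrix Finset

namespace Literature.Combinatorics.Optimization

/-! ### The nested rectangles `P = [−a,a] × [−b,b] ⊆ Q = [−1,1]²` -/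

/-- The corners of the rectangle `[−a,a] × [−b,b]`, counterclockwise from `(−a,−b)` (the row order
of the printed matrix `M`). [cite: FawziEtAl2015, Ex. 3.6 (p10)] -/
def rectVertex (a b : ℝ) : Fin 4 → (Fin 2 → ℝ) := ![![-a, -b], ![a, -b], ![a, b], ![-a, b]]

/-- The square `Q = [−1,1]² = {y : n_j·y ≤ 1}` through its four facet normals `e₁, e₂, −e₁, −e₂`
(the column order of the printed `M`: slacks `1 − y₁, 1 − y₂, 1 + y₁, 1 + y₂`); read as POINTS, the
`n_j` are the vertices of the polar diamond `Q° = conv{±e₁, ±e₂}`. [cite: FawziEtAl2015, Ex. 3.6 (p10)] -/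
def squareNormal : Fin 4 → (Fin 2 → ℝ) := ![![1, 0], ![0, 1], ![-1, 0], ![0, -1]]

/-- **The slack matrix of the pair (rectangle, square)** of Example 3.6:
`M(a,b) = S_{P,Q}`, `P = [−a,a]×[−b,b]`, `Q = [−1,1]²`. [cite: FawziEtAl2015, Ex. 3.6 (p10)] -/
def nestedRectSlack (a b : ℝ) : Fin 4 → Fin 4 → ℝ :=
  pairSlackMatrix (rectVertex a b) squareNormal fun _ => 1

/-- `M(a,b)` is the printed matrix
`[[1+a,1+b,1−a,1−b],[1−a,1+b,1+a,1−b],[1−a,1−b,1+a,1+b],[1+a,1−b,1−a,1+b]]`.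
[cite: FawziEtAl2015, Ex. 3.6 (p10)] -/
theorem nestedRectSlack_eq (a b : ℝ) : nestedRectSlack a b =
    Matrix.of ![![1 + a, 1 + b, 1 - a, 1 - b], ![1 - a, 1 + b, 1 + a, 1 - b],
      ![1 - a, 1 - b, 1 + a, 1 + b], ![1 + a, 1 - b, 1 - a, 1 + b]] := by
  funext i j
  fin_cases i <;> fin_cases j <;>
    simp [nestedRectSlack, pairSlackMatrix, rectVertex, squareNormal, dotProduct, Fin.sum_univ_two]

/-- The square `[−1,1]²` is bounded. [cite: FawziEtAl2015, Ex. 3.6 (p10)] -/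
theorem isBounded_square : Bornology.IsBounded {y : Fin 2 → ℝ | ∀ j, squareNormal j ⬝ᵥ y ≤ 1} := by
  refine (Metric.isBounded_Icc (fun _ : Fin 2 => (-1 : ℝ)) (fun _ => 1)).subset fun y hy => ?_
  simp only [Set.mem_setOf_eq] at hy
  have h0 := hy 0; have h1 := hy 1; have h2 := hy 2; have h3 := hy 3
  simp [squareNormal, dotProduct, Fin.sum_univ_two] at h0 h1 h2 h3
  refine ⟨fun i => ?_, fun i => ?_⟩ <;> fin_cases i <;> simp <;> linarith

/-- The polar diamond `conv{e₁, e₂, −e₁, −e₂}` is a convex quadrilateral (all off-edge slacks equal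
`2`). [cite: FawziEtAl2015, Ex. 3.6 (p10)] -/
theorem isConvexPolygon_squareNormal : IsConvexPolygon squareNormal := by
  intro i j hij hij1
  fin_cases i <;> fin_cases j <;> simp_all [polygonSlack_apply, squareNormal]


/-- Entries of `M(a,b)`: `M_{ij} = 1 − n_j · v_i`. [cite: FawziEtAl2015, Ex. 3.6 (p10)] -/
theorem nestedRectSlack_apply (a b : ℝ) (i j : Fin 4) :
    nestedRectSlack a b i j = 1 - squareNormal j ⬝ᵥ rectVertex a b i := rfl

/-- For `0 ≤ a, b ≤ 1` the rectangle lies in the square: `M(a,b)` is entrywise nonnegative.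
[cite: FawziEtAl2015, Ex. 3.6 (p10)] -/
theorem nestedRectSlack_nonneg {a b : ℝ} (ha : 0 ≤ a) (ha1 : a ≤ 1) (hb : 0 ≤ b) (hb1 : b ≤ 1)
    (i j : Fin 4) : 0 ≤ nestedRectSlack a b i j := by
  rw [nestedRectSlack_eq]
  fin_cases i <;> fin_cases j <;> simp <;> linarith

/-- The rectangle's corners satisfy the square's inequalities (`0 ≤ a, b ≤ 1`).
[cite: FawziEtAl2015, Ex. 3.6 (p10)] -/
theorem rectVertex_mem_square {a b : ℝ} (ha : 0 ≤ a) (ha1 : a ≤ 1) (hb : 0 ≤ b) (hb1 : b ≤ 1)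
    (i j : Fin 4) : squareNormal j ⬝ᵥ rectVertex a b i ≤ 1 := by
  have h := nestedRectSlack_nonneg ha ha1 hb hb1 i j
  rw [nestedRectSlack_apply] at h
  linarith

/-! ### `rank_psd M(a,b) ≤ 3` (the spectrahedron of size `3` projecting onto the square) -/

/-- **Upper bound** (p10: "we saw a spectrahedron of size 3 which projects onto `Q = [−1,1]²` and
thus this shows that `rank_psd M ≤ 3` for all `a, b ≤ 1`"): here through the transpose — `M(a,b)ᵀ` is
the generalized slack matrix of the polar diamond `conv{±e₁, ±e₂}` (a quadrilateral, psd rank `3`,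
GRT13 Thm. 4.7) against the valid functionals `y ↦ 1 − v_i·y`, so GRT Prop. 3.6 at matrix level
(`IsConvexPolygon.hasPsdFactorization_of_valid`) gives size `3`. [cite: FawziEtAl2015, Ex. 3.6 (p10)] -/
theorem hasPsdFactorization_nestedRectSlack_three {a b : ℝ} (ha : 0 ≤ a) (ha1 : a ≤ 1) (hb : 0 ≤ b)
    (hb1 : b ≤ 1) : HasPsdFactorization (nestedRectSlack a b) 3 := by
  have hQ := isConvexPolygon_squareNormal
  have h3 : HasPsdFactorization (polygonSlack squareNormal) 3 :=
    (GouveiaRobinsonThomas2013_thm47 hQ (by norm_num)).mpr le_rfl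
  have h := hQ.hasPsdFactorization_of_valid (by norm_num) h3 (fun i => -rectVertex a b i) (fun _ => 1)
    (fun i j => by
      rw [neg_dotProduct, dotProduct_comm]
      have := rectVertex_mem_square ha ha1 hb hb1 i j
      linarith)
  have hfun : nestedRectSlack a b = fun i j => (fun j i => -rectVertex a b i ⬝ᵥ squareNormal j + 1) j i := by
    funext i j
    show 1 - squareNormal j ⬝ᵥ rectVertex a b i = -rectVertex a b i ⬝ᵥ squareNormal j + 1
    rw [neg_dotProduct, dotProduct_comm]
    ring
  rw [hfun]
  exact h.transpose

/-! ### `rank M(a,b) = 3` for `ab ≠ 0` -/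

/-- Selecting rows `f` and columns `g` is multiplication by `0/1` matrices, so the rank of a
submatrix is at most the rank of the matrix. [folklore] -/
private theorem rank_submatrix_le' {m n p q : Type*} [Fintype m] [Fintype n] [Fintype p] [Fintype q]
    [DecidableEq m] [DecidableEq n] (A : Matrix m n ℝ) (f : p → m) (g : q → n) :
    (A.submatrix f g).rank ≤ A.rank := by
  let P : Matrix p m ℝ := Matrix.of fun i k => if f i = k then 1 else 0
  let R : Matrix n q ℝ := Matrix.of fun k j => if k = g j then 1 else 0
  have h : A.submatrix f g = P * A * R := by
    ext i j
    simp [P, R, Matrix.mul_apply, Finset.sum_ite_eq, Finset.sum_ite_eq']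
  rw [h]
  exact (Matrix.rank_mul_le_left _ _).trans (Matrix.rank_mul_le_right _ _)

/-- `M(a,b)` has rank at most `3` (it factors through `ℝ³`: rows `(1, v_i)`, columns `(1, −n_j)`).
[cite: FawziEtAl2015, Ex. 3.6 (p10)] -/
theorem rank_nestedRectSlack_le (a b : ℝ) : (Matrix.of (nestedRectSlack a b)).rank ≤ 3 := by
  let U : Matrix (Fin 4) (Fin 3) ℝ := Matrix.of fun i k => ![1, rectVertex a b i 0, rectVertex a b i 1] k
  let V : Matrix (Fin 3) (Fin 4) ℝ := Matrix.of fun k j => ![1, -squareNormal j 0, -squareNormal j 1] k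
  have h : Matrix.of (nestedRectSlack a b) = U * V := by
    ext i j
    simp [U, V, Matrix.mul_apply, Fin.sum_univ_three, nestedRectSlack_apply, dotProduct, Fin.sum_univ_two]
    ring
  rw [h]
  exact (Matrix.rank_mul_le_left _ _).trans (by simpa using Matrix.rank_le_width U)

/-- For `a b ≠ 0` the rank of `M(a,b)` is exactly `3`: the top-left `3 × 3` minor is `8ab`.
[cite: FawziEtAl2015, Ex. 3.6 (p10)] -/
theorem rank_nestedRectSlack {a b : ℝ} (ha : a ≠ 0) (hb : b ≠ 0) :
    (Matrix.of (nestedRectSlack a b)).rank = 3 := by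
  refine le_antisymm (rank_nestedRectSlack_le a b) ?_
  let f : Fin 3 → Fin 4 := Fin.castSucc
  have hdet : ((Matrix.of (nestedRectSlack a b)).submatrix f f).det = 8 * a * b := by
    rw [nestedRectSlack_eq, Matrix.det_fin_three]
    simp [f]
    ring
  have hunit : IsUnit ((Matrix.of (nestedRectSlack a b)).submatrix f f) := by
    rw [Matrix.isUnit_iff_isUnit_det, hdet, isUnit_iff_ne_zero]
    exact mul_ne_zero (mul_ne_zero (by norm_num) ha) hb
  have h3 : ((Matrix.of (nestedRectSlack a b)).submatrix f f).rank = 3 := by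
    rw [Matrix.rank_of_isUnit _ hunit, Fintype.card_fin]
  exact h3.symm.le.trans (rank_submatrix_le' _ f f)

/-! ### Ellipses between the rectangle and the square: `a² + b² ≤ 1` -/

/-- If every `t ≥ 0` for which one of `d t² ± 2et + γ ≤ 0` holds satisfies `t ≤ 1` (`d > 0`),
then `−γ ≤ d` (take `t = √(−γ/d)`). [folklore] -/
private theorem neg_le_of_axis {d γ : ℝ} (hd : 0 < d) {e : ℝ}
    (h : ∀ t : ℝ, 0 ≤ t → (d * t ^ 2 + 2 * e * t + γ ≤ 0 ∨ d * t ^ 2 - 2 * e * t + γ ≤ 0) → t ≤ 1) :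
    -γ ≤ d := by
  by_contra hlt
  push Not at hlt
  have hpos : 0 < -γ / d := div_pos (by linarith) hd
  set t := Real.sqrt (-γ / d) with ht
  have ht0 : 0 ≤ t := Real.sqrt_nonneg _
  have ht2 : d * t ^ 2 = -γ := by
    rw [Real.sq_sqrt hpos.le]; field_simp
  have ht1 : 1 < t := by
    rw [ht, Real.lt_sqrt zero_le_one, one_pow, lt_div_iff₀ hd]
    linarith
  have hle : t ≤ 1 := by
    refine h t ht0 ?_
    rcases le_or_gt (e * t) 0 with he | he
    · left; linarith
    · right; linarith
  linarith

/-- **The geometric heart of Example 3.6** (p10: "such an ellipse exists if and only if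
`a² + b² ≤ 1`"), necessity: if a nondegenerate ellipse `{y : yᵀAy + 2cᵀy + γ ≤ 0}` (`A ≻ 0`)
contains the four corners `(±a, ±b)` and lies in the square `[−1,1]²`, then `a² + b² ≤ 1`. Proof:
average the quadratic over the four sign changes `y ↦ (±y₁, ±y₂)` — the linear and mixed terms
cancel, leaving `A₁₁y₁² + A₂₂y₂² + γ`, nonpositive at `(a,b)` (average of four nonpositive values);
a point `(t, 0)` with `A₁₁t² + γ = 0` has some sign change inside the ellipse, hence in the square,
so `−γ ≤ A₁₁`, and likewise `−γ ≤ A₂₂`; then `(a² + b²)(−γ) ≤ A₁₁a² + A₂₂b² ≤ −γ`.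
[cite: FawziEtAl2015, Ex. 3.6 (p10)] -/
theorem sq_add_sq_le_one_of_ellipse_between {a b : ℝ} (A : Matrix (Fin 2) (Fin 2) ℝ)
    (c : Fin 2 → ℝ) (γ : ℝ) (hA : A.PosDef)
    (hP : ∀ i, rectVertex a b i ⬝ᵥ (A *ᵥ rectVertex a b i) + 2 * (c ⬝ᵥ rectVertex a b i) + γ ≤ 0)
    (hQ : ∀ y : Fin 2 → ℝ, y ⬝ᵥ (A *ᵥ y) + 2 * (c ⬝ᵥ y) + γ ≤ 0 → ∀ j, squareNormal j ⬝ᵥ y ≤ 1) :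
    a ^ 2 + b ^ 2 ≤ 1 := by
  -- the quadratic in coordinates
  have hq : ∀ y : Fin 2 → ℝ, y ⬝ᵥ (A *ᵥ y) + 2 * (c ⬝ᵥ y) + γ =
      A 0 0 * y 0 ^ 2 + (A 0 1 + A 1 0) * y 0 * y 1 + A 1 1 * y 1 ^ 2 + 2 * (c 0 * y 0 + c 1 * y 1) + γ := by
    intro y
    simp [dotProduct, mulVec, Fin.sum_univ_two]
    ring
  have hA00 : 0 < A 0 0 := by simpa using hA.diag_pos (i := 0)
  have hA11 : 0 < A 1 1 := by simpa using hA.diag_pos (i := 1)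
  -- average over the four corners: the mixed and linear terms cancel
  have h0 := hP 0; have h1 := hP 1; have h2 := hP 2; have h3 := hP 3
  rw [hq] at h0 h1 h2 h3
  simp [rectVertex] at h0 h1 h2 h3
  have havg : A 0 0 * a ^ 2 + A 1 1 * b ^ 2 + γ ≤ 0 := by
    ring_nf at h0 h1 h2 h3 ⊢
    linarith
  -- the symmetrised ellipse meets the coordinate axes inside the square
  have hx : -γ ≤ A 0 0 := by
    refine neg_le_of_axis hA00 (e := c 0) fun t ht hor => ?_
    rcases hor with h | h
    · have hy : ![t, 0] ⬝ᵥ (A *ᵥ ![t, 0]) + 2 * (c ⬝ᵥ ![t, 0]) + γ ≤ 0 := by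
        rw [hq]; simp; linarith
      have := hQ _ hy 0
      simpa [squareNormal, dotProduct, Fin.sum_univ_two] using this
    · have hy : ![-t, 0] ⬝ᵥ (A *ᵥ ![-t, 0]) + 2 * (c ⬝ᵥ ![-t, 0]) + γ ≤ 0 := by
        rw [hq]; simp; linarith
      have := hQ _ hy 2
      simpa [squareNormal, dotProduct, Fin.sum_univ_two] using this
  have hy : -γ ≤ A 1 1 := by
    refine neg_le_of_axis hA11 (e := c 1) fun t ht hor => ?_
    rcases hor with h | h
    · have hy : ![0, t] ⬝ᵥ (A *ᵥ ![0, t]) + 2 * (c ⬝ᵥ ![0, t]) + γ ≤ 0 := by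
        rw [hq]; simp; linarith
      have := hQ _ hy 1
      simpa [squareNormal, dotProduct, Fin.sum_univ_two] using this
    · have hy : ![0, -t] ⬝ᵥ (A *ᵥ ![0, -t]) + 2 * (c ⬝ᵥ ![0, -t]) + γ ≤ 0 := by
        rw [hq]; simp; linarith
      have := hQ _ hy 3
      simpa [squareNormal, dotProduct, Fin.sum_univ_two] using this
  -- conclusion
  have ha2 : 0 ≤ A 0 0 * a ^ 2 := mul_nonneg hA00.le (sq_nonneg a)
  have hb2 : 0 ≤ A 1 1 * b ^ 2 := mul_nonneg hA11.le (sq_nonneg b)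
  by_cases hγ : γ = 0
  · have ha0 : a ^ 2 ≤ 0 := by
      by_contra h
      push Not at h
      nlinarith [mul_pos hA00 h]
    have hb0 : b ^ 2 ≤ 0 := by
      by_contra h
      push Not at h
      nlinarith [mul_pos hA11 h]
    linarith
  · have hγneg : 0 < -γ := by
      rcases lt_or_gt_of_ne hγ with h | h
      · linarith
      · linarith
    have h1 : a ^ 2 * (-γ) ≤ A 0 0 * a ^ 2 := by nlinarith [sq_nonneg a]
    have h2 : b ^ 2 * (-γ) ≤ A 1 1 * b ^ 2 := by nlinarith [sq_nonneg b]
    have h3 : (a ^ 2 + b ^ 2) * (-γ) ≤ 1 * (-γ) := by linarith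
    exact le_of_mul_le_mul_right h3 hγneg

/-! ### Example 3.6: the psd rank of `M(a,b)` -/

/-- **Example 3.6, the middle case** (p10: "the psd rank of `M` is equal to 2 if, and only if, there
is an ellipse `E` such that `P ⊆ E ⊆ Q` … such an ellipse exists if and only if `a² + b² ≤ 1`"):
for `0 ≤ a, b ≤ 1`, `M(a,b)` has a psd factorization of size `2` iff `a² + b² ≤ 1`. "⇐": the unit
disk is sandwiched (`hasPsdLift_ellipse`, Thm. 3.3); "⇒": for `ab ≠ 0` the matrix has rank `3` and
§4 (`FawziEtAl2015_sec4_ellipse_holds`) produces a sandwiched ellipse, whence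
`sq_add_sq_le_one_of_ellipse_between`; for `ab = 0` the bound is automatic.
[cite: FawziEtAl2015, Ex. 3.6 (p10)] -/
theorem hasPsdFactorization_nestedRectSlack_two_iff {a b : ℝ} (ha : 0 ≤ a) (ha1 : a ≤ 1) (hb : 0 ≤ b)
    (hb1 : b ≤ 1) : HasPsdFactorization (nestedRectSlack a b) 2 ↔ a ^ 2 + b ^ 2 ≤ 1 := by
  constructor
  · intro h2
    by_cases hab : a = 0 ∨ b = 0
    · rcases hab with rfl | rfl <;> nlinarith
    · push Not at hab
      obtain ⟨A, c, γ, hA, hP, hEQ⟩ := (FawziEtAl2015_sec4_ellipse_holds 4 4 (rectVertex a b)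
        squareNormal (fun _ => 1) (rectVertex_mem_square ha ha1 hb hb1) isBounded_square
        (rank_nestedRectSlack hab.1 hab.2)).mp h2
      exact sq_add_sq_le_one_of_ellipse_between A c γ hA hP hEQ
  · intro h
    have hdisk := hasPsdLift_ellipse (1 : Matrix (Fin 2) (Fin 2) ℝ) 0 (-1) Matrix.PosDef.one
    refine hdisk.hasPsdFactorization_pairSlackMatrix (by norm_num) (fun i => ?_) (fun y hy j => ?_)
      isBounded_square
    · show rectVertex a b i ⬝ᵥ ((1 : Matrix (Fin 2) (Fin 2) ℝ) *ᵥ rectVertex a b i) +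
        2 * ((0 : Fin 2 → ℝ) ⬝ᵥ rectVertex a b i) + (-1) ≤ 0
      fin_cases i <;> simp [rectVertex, dotProduct, Fin.sum_univ_two] <;> nlinarith
    · have hy' : y 0 * y 0 + y 1 * y 1 ≤ 1 := by
        have := hy
        simp [dotProduct, Fin.sum_univ_two] at this
        linarith
      fin_cases j <;> simp [squareNormal, dotProduct, Fin.sum_univ_two] <;>
        nlinarith [sq_nonneg (y 0), sq_nonneg (y 1), sq_nonneg (y 0 - 1), sq_nonneg (y 1 - 1),
          sq_nonneg (y 0 + 1), sq_nonneg (y 1 + 1)]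

/-- **Example 3.6, the smallest case** (p10: "`rank_psd M = 1` if `a = b = 0`", and only then): for
`0 ≤ a, b ≤ 1`, `M(a,b)` has a psd factorization of size `1` iff `a = b = 0` (a size-`1`
factorization makes `M` rank one, but `M₀₀M₁₂ − M₀₂M₁₀ = (1+a)² − (1−a)² = 4a` and
`M₀₁M₃₃ − M₀₃M₃₁ = 4b`). [cite: FawziEtAl2015, Ex. 3.6 (p10)] -/
theorem hasPsdFactorization_nestedRectSlack_one_iff (a b : ℝ) :
    HasPsdFactorization (nestedRectSlack a b) 1 ↔ a = 0 ∧ b = 0 := by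
  constructor
  · rintro ⟨A, B, -, -, hM⟩
    have hM' : ∀ i j, nestedRectSlack a b i j = A i 0 0 * B j 0 0 := fun i j => by
      rw [hM i j, Matrix.trace_fin_one, Matrix.mul_apply, Fin.sum_univ_one]
    have v : nestedRectSlack a b 0 0 = 1 + a ∧ nestedRectSlack a b 0 2 = 1 - a ∧
        nestedRectSlack a b 1 0 = 1 - a ∧ nestedRectSlack a b 1 2 = 1 + a ∧
        nestedRectSlack a b 0 1 = 1 + b ∧ nestedRectSlack a b 0 3 = 1 - b ∧
        nestedRectSlack a b 3 1 = 1 - b ∧ nestedRectSlack a b 3 3 = 1 + b := by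
      rw [nestedRectSlack_eq]; simp
    obtain ⟨v00, v02, v10, v12, v01, v03, v31, v33⟩ := v
    constructor
    · have h : (1 + a) * (1 + a) = (1 - a) * (1 - a) :=
        calc (1 + a) * (1 + a) = nestedRectSlack a b 0 0 * nestedRectSlack a b 1 2 := by rw [v00, v12]
          _ = (A 0 0 0 * B 0 0 0) * (A 1 0 0 * B 2 0 0) := by rw [hM', hM']
          _ = (A 0 0 0 * B 2 0 0) * (A 1 0 0 * B 0 0 0) := by ring
          _ = nestedRectSlack a b 0 2 * nestedRectSlack a b 1 0 := by rw [hM' 0 2, hM' 1 0]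
          _ = (1 - a) * (1 - a) := by rw [v02, v10]
      nlinarith
    · have h : (1 + b) * (1 + b) = (1 - b) * (1 - b) :=
        calc (1 + b) * (1 + b) = nestedRectSlack a b 0 1 * nestedRectSlack a b 3 3 := by rw [v01, v33]
          _ = (A 0 0 0 * B 1 0 0) * (A 3 0 0 * B 3 0 0) := by rw [hM', hM']
          _ = (A 0 0 0 * B 3 0 0) * (A 3 0 0 * B 1 0 0) := by ring
          _ = nestedRectSlack a b 0 3 * nestedRectSlack a b 3 1 := by rw [hM' 0 3, hM' 3 1]
          _ = (1 - b) * (1 - b) := by rw [v03, v31]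
      nlinarith
  · rintro ⟨rfl, rfl⟩
    refine HasPsdFactorization.of_nonnegFactorization (k := 1) (fun _ _ => 1) (fun _ _ => 1)
      (by norm_num) (by norm_num) fun i j => ?_
    rw [nestedRectSlack_eq]
    fin_cases i <;> fin_cases j <;> simp

/-- **FGPRT Example 3.6** (p10, verbatim): "Let `Q = [−1,1]²` and let now `P = [−a,a] × [−b,b]` … with
`0 ≤ a, b ≤ 1` … `rank_psd M = 3` if `a² + b² > 1`, `2` if `0 < a² + b² ≤ 1`, `1` if `a = b = 0`."
PROVED, as the three threshold statements: size `3` always; size `2` iff `a² + b² ≤ 1`; size `1` iff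
`a = b = 0`. [cite: FawziEtAl2015, Ex. 3.6 (p10)] -/
theorem FawziEtAl2015_ex36 {a b : ℝ} (ha : 0 ≤ a) (ha1 : a ≤ 1) (hb : 0 ≤ b) (hb1 : b ≤ 1) :
    HasPsdFactorization (nestedRectSlack a b) 3 ∧
      (HasPsdFactorization (nestedRectSlack a b) 2 ↔ a ^ 2 + b ^ 2 ≤ 1) ∧
      (HasPsdFactorization (nestedRectSlack a b) 1 ↔ a = 0 ∧ b = 0) :=
  ⟨hasPsdFactorization_nestedRectSlack_three ha ha1 hb hb1,
    hasPsdFactorization_nestedRectSlack_two_iff ha ha1 hb hb1,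
    hasPsdFactorization_nestedRectSlack_one_iff a b⟩

/-- Example 3.6 as the printed case distinction on `rank_psd M(a,b)`: exactly `3` (size `3`, not `2`)
iff `a² + b² > 1`; exactly `2` iff `0 < a² + b² ≤ 1`; exactly `1` iff `a = b = 0`.
[cite: FawziEtAl2015, Ex. 3.6 (p10)] -/
theorem FawziEtAl2015_ex36_cases {a b : ℝ} (ha : 0 ≤ a) (ha1 : a ≤ 1) (hb : 0 ≤ b) (hb1 : b ≤ 1) :
    (HasPsdFactorization (nestedRectSlack a b) 3 ∧ ¬ HasPsdFactorization (nestedRectSlack a b) 2 ↔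
        1 < a ^ 2 + b ^ 2) ∧
      (HasPsdFactorization (nestedRectSlack a b) 2 ∧ ¬ HasPsdFactorization (nestedRectSlack a b) 1 ↔
        0 < a ^ 2 + b ^ 2 ∧ a ^ 2 + b ^ 2 ≤ 1) ∧
      (HasPsdFactorization (nestedRectSlack a b) 1 ↔ a = 0 ∧ b = 0) := by
  obtain ⟨h3, h2, h1⟩ := FawziEtAl2015_ex36 ha ha1 hb hb1
  refine ⟨?_, ?_, h1⟩
  · rw [h2]
    exact ⟨fun h => not_le.mp h.2, fun h => ⟨h3, not_le.mpr h⟩⟩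
  · rw [h2, h1]
    constructor
    · rintro ⟨hle, hne⟩
      refine ⟨?_, hle⟩
      rcases (add_nonneg (sq_nonneg a) (sq_nonneg b)).lt_or_eq with h | h
      · exact h
      · exfalso
        apply hne
        constructor <;> nlinarith [sq_nonneg a, sq_nonneg b]
    · rintro ⟨hpos, hle⟩
      refine ⟨hle, ?_⟩
      rintro ⟨rfl, rfl⟩
      norm_num at hpos

/-! ### GRT "Worst-case results", Example 4.2: the nested squares `(1−ε)P ⊆ P` -/

/-- The slack matrix `M_ε = S_{(1−ε)P, P}` of the `±1` square `P` and its scaled copy (GRT 2015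
Example 4.2) is the nested-rectangle matrix with `a = b = 1 − ε`. [cite: GouveiaRobinsonThomas2015, Ex. 4.2 (p08)] -/
def nestedSquareSlack (ε : ℝ) : Fin 4 → Fin 4 → ℝ := nestedRectSlack (1 - ε) (1 - ε)

/-- `M_ε` is the printed matrix
`[[2−ε,2−ε,ε,ε],[ε,2−ε,2−ε,ε],[ε,ε,2−ε,2−ε],[2−ε,ε,ε,2−ε]]`. [cite: GouveiaRobinsonThomas2015, Ex. 4.2 (p08)] -/
theorem nestedSquareSlack_eq (ε : ℝ) : nestedSquareSlack ε =
    Matrix.of ![![2 - ε, 2 - ε, ε, ε], ![ε, 2 - ε, 2 - ε, ε], ![ε, ε, 2 - ε, 2 - ε],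
      ![2 - ε, ε, ε, 2 - ε]] := by
  rw [nestedSquareSlack, nestedRectSlack_eq]
  funext i j
  fin_cases i <;> fin_cases j <;> simp <;> ring

/-- **GRT 2015 Example 4.2** (p08, verbatim): "`rank_psd M_ε = 1` if `ε = 1`; `2` if
`ε ∈ [1 − √2/2, 1)`; `3` if `ε ∈ [0, 1 − √2/2)`" ("we can put a half-conic between `(1−ε)P` and `P` if
and only if `1 − ε ≤ √2/2` … the square itself has psd rank three"). PROVED as threshold statements
for `ε ∈ [0,1]`: size `3` always; size `2` iff `1 − ε ≤ √2/2`; size `1` iff `ε = 1`.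
[cite: GouveiaRobinsonThomas2015, Ex. 4.2 (p08)] -/
theorem GouveiaRobinsonThomas2015_ex42 {ε : ℝ} (h0 : 0 ≤ ε) (h1 : ε ≤ 1) :
    HasPsdFactorization (nestedSquareSlack ε) 3 ∧
      (HasPsdFactorization (nestedSquareSlack ε) 2 ↔ 1 - ε ≤ Real.sqrt 2 / 2) ∧
      (HasPsdFactorization (nestedSquareSlack ε) 1 ↔ ε = 1) := by
  obtain ⟨h3, h2, h1'⟩ := FawziEtAl2015_ex36 (a := 1 - ε) (b := 1 - ε) (by linarith) (by linarith)
    (by linarith) (by linarith)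
  refine ⟨h3, ?_, ?_⟩
  · rw [nestedSquareSlack, h2]
    have hs : (Real.sqrt 2 / 2) ^ 2 = 1 / 2 := by
      rw [div_pow, Real.sq_sqrt (by norm_num : (0:ℝ) ≤ 2)]; norm_num
    have hsnn : 0 ≤ Real.sqrt 2 / 2 := by positivity
    rw [← pow_le_pow_iff_left₀ (by linarith : 0 ≤ 1 - ε) hsnn two_ne_zero, hs]
    constructor <;> intro h <;> linarith
  · rw [nestedSquareSlack, h1']
    constructor
    · rintro ⟨h, -⟩; linarith
    · intro h; constructor <;> linarith


end Literature.Combinatorics.Optimization
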